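import Summits.QuantumFields.BalabanUV.Beta.GAN24.KSlotJMHolds

/-!
# `BalabanUV.Beta.GAN24.KPerfTailRate` — binder row G-an2-4 ∕ (CONV-C), lineage gan24-p3 (part P3, Woodbury ∕ fibre layer):
# **THE STRIP HALF-WIDTH OF ROAD P1's (I3′) IS THE SAME AT EVERY RELATIVE BLOCKING `Lc^m`** — hence the (j, m)-resolvents and the PERFECT
# `m`-fold one-step resolvent `KPerf Lc (sfStep Lc) (smStep 3 Lc) m` decay at rate `δ₀ ∕ n`, `n = Lc^m`, with ONE `δ₀ > 0` FOR ALL `m` (and all `Lc ≥ 1`)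
# — the RATE half of road FP's N7c ∕ `REP-DESIGN.md` row TAILS («the END wants `e^{−(δ∕n)(r+1)}` with n-FREE δ»); the AMPLITUDE constant is DISPLAYED
# (road P1's `FibreStripOfRows.cstU … (Lc^m) …`) and is NOT claimed to be `n`-uniform

NOT IN PRINT; OUR PROOF (bookkeeping over tree theorems BY NAME).  HONEST FRAMING (cell contract, verbatim): «discharging `BetaPertH` makes Bałaban's
UV stability UNCONDITIONAL — a real constructive-QFT result; it is NOT the continuum limit and NOT the Clay problem.»  HONEST DEPENDENCY (verbatim):
«continuum YM on T⁴ ⇐ BetaPertH ∧ nine spine estimates (0/9 proved); BetaPertH ⇐ (D1) ∧ (D4) ∧ CAP+tail; G-an2-4 gates asym, D1 and NE2/3/4.»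

THE OBSERVATION.  In `FibreStripJMHolds.stripRegularKM_of_rows` (gen 14) the strip half-width is produced by road P1's `FibreDetStripOfAnchors.exists_radii`
from the ROW CONSTANTS ONLY — `aZ = 5∕2` (F3 `ArrowAnchorZero.isUnit_innerArrow_zero`), `aR = ArrowAnchorReal.aR 4` (F5), `cIn` of `ArrowInnerShift.exists_cIn 3` (F4),
`cOut4` and the modulus `OmegaOut` of `FibreStrip` (F6), `ρ₁ = 1∕2`, `η₁ = 1` — none of which depends on the relative blocking `m` (nor on `Lc`): the four rows are
ONE-`N` generic for every `N ≥ 1`, and they were merely INSTANTIATED at `N := Lc^(j+m)`.  So the existential `κ` of `stripRegularKM_holds m` can be chosen ONCE for all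
`m`; only the a-priori leg constant (U2), `cstU aR κ (Lc^m) ρ₀`, carries `Lc^m`.  This file re-runs that proof with `exists_radii` hoisted in front of `∀ m`.

CONTENT (`d = 3`; [our proof] ∕ [folklore]):
* §1 **`stripRegularKM_uniform : ∃ κ, 0 < κ ∧ κ ≤ 1∕4 ∧ ∃ ρ₀, 0 < ρ₀ ∧ ∀ m, StripRegularKM 3 Lc m κ (cstU (ArrowAnchorReal.aR 4) κ (Lc^m) ρ₀)`** (every `Lc ≥ 1`).
* §2 **`uniformDecaysKM_uniformRate`**: `∃ δ₀ > 0, ∀ m, ∃ C ≥ 0, UniformDecays (j ↦ unitK (sfStep Lc j) (smStep 3 Lc j) (KTot (Lc^(j+m)) (Lc^j))) C (δ₀ ∕ Lc^m)` — ONE rate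
  constant `δ₀ = κ∕(3+1)` for the whole two-parameter family (every `Lc ≥ 1`, every `m`, every `j`); `decays_KTot_uniformRate` (bare `∀ m j, Decays …` form).
* §3 (`2 ≤ Lc`, `1 ≤ m`: X1m-K BY NAME through `KSlotJMHolds.decays_KPerf_explicit`) **`decays_KPerf_uniformRate : ∃ δ₀ > 0, ∀ m ≥ 1, ∃ C ≥ 0,
  Decays (KPerf Lc (sfStep Lc) (smStep 3 Lc) m) C (δ₀ ∕ Lc^m)`** and the `n = Lc^m`-indexed reading `decays_KPerf_uniformRate_nat`
  (`Decays (KPerf … m) C (δ₀ ∕ n)`, `n := ((Lc^m : ℕ) : ℝ)`): the perfect one-step resolvent at base `n` decays at rate `δ₀∕n` in step-lattice `ℓ¹` distance — n-FREE `δ₀`.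
WHAT THIS IS NOT (recorded so that no reader over-reads it): the constant `C = cstU (aR 4) κ (Lc^m) ρ₀ · e^{2κ}` is road P1's (U2) a-priori constant read at ratio
`Lc^m`; `StripLegUnits.cstSq` contains the factor `Real.exp (κ·(4·Lc^m))^4 · (Lc^m)^12`, so `C` GROWS EXPONENTIALLY in `n = Lc^m` and the product bound
`C·e^{−(δ₀∕n)|x′−y′|₁}` is informative only for `|x′ − y′|₁ ≳ n²`: the END's tail AMPLITUDE `R′∕(r+1)^a` (an `n`-uniform, power-law prefactor on the window scale
`|w| ~ n`) is NOT delivered here — that is the window analysis of rows N7b ∕ GERM-K, or an `n`-uniform re-derivation of (U2); the RATE `δ₀∕n` with `n`-free `δ₀` IS.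
0 wall binders instantiated; NEVER «G-an2-4 closed», NOT (CONV-C) for G_k∕H_k, NOT N7c, NOT D1, NOT BetaPertH, NOT continuum, NOT Clay.

ABSOLUTE RULE (cell, verbatim): «No internally-minted statement may enter as a cited fact. Every hypothesis is either kernel-proved in this package or a
verbatim quotation of a PUBLISHED theorem with page reference.»  Nothing is cited; no `def`; every input is a tree theorem imported BY NAME.
-/

noncomputable section

open Matrix Complex Finset
open scoped Matrix.Norms.L2Operator Real BigOperators
open Literature.MathematicalPhysics.QuantumFieldTheory
open Literature.MathematicalPhysics.QuantumFieldTheory.Balaban1983to89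
open Literature.MathematicalPhysics.QuantumFieldTheory.Balaban1983to89.Beta
open Literature.MathematicalPhysics.QuantumFieldTheory.LatticeForm (quo repZ)
open Literature.Probability.LatticeModels (TorusSite)
open B4Strip (Strip reVec ofRealVec)
open B4ContourShift (BZ)
open BlochFibreMatrix (stencil pieceMatrix)
open FibreInverseDecay (trigPolySymbol reVec_mem_BZ)
open ExpKernelCalculus (Decays)
open OneStepResolventKernel (Fib)
open Summit.QuantumFields.BalabanUV.Beta.HessKerDressedUnits (unitK)
open Summit.QuantumFields.BalabanUV.Beta.GAN24.CombesThomas (sfStep smStep UniformDecays)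
open Summit.QuantumFields.BalabanUV.Beta.GAN24.ArrowOperator
open Summit.QuantumFields.BalabanUV.Beta.GAN24.ArrowScaling
open Summit.QuantumFields.BalabanUV.Beta.GAN24.ArrowAnchorZero (isUnit_innerArrow_zero)
open Summit.QuantumFields.BalabanUV.Beta.GAN24.FibreDetStripOfAnchors (exists_radii)
open Summit.QuantumFields.BalabanUV.Beta.GAN24.FibreDetStrip (apriori_of_rows det_ne_zero_of_rows abs_le_pi_of_mem_BZ)
open Summit.QuantumFields.BalabanUV.Beta.GAN24.StripLegUnits (cstSq cstSq_nonneg cstSq_mono)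
open Summit.QuantumFields.BalabanUV.Beta.GAN24.FibreStripOfRows (radI_hyps radO_hyps radO_zero_le le_radO_zero cstU)
open Summit.QuantumFields.BalabanUV.Beta.GAN24.FibreStrip (omegaOut OmegaOut omegaOut_le OmegaOut_nonneg cOut4 cOut4_nonneg)
open Summit.QuantumFields.BalabanUV.Beta.GAN24.FibreStripJM (kFibΔM StripRegularKM kFibΔM_repZ_eq_kFibW stripRegularKM_of_repZ stripRegular_kFibΔM
  uniformDecays_of_stripRegularKM cst_nonneg_of_stripRegularKM)
open Summit.QuantumFields.BalabanUV.Beta.GAN24.FibreStripJMHolds (one_le_pow_add legBound_jm_of_inv_bound)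
open Summit.QuantumFields.BalabanUV.Beta.GAN24.KSlotJMHolds (decays_KPerf_explicit)
open Summit.QuantumFields.BalabanUV.Beta.FP.PerfectObjects (KTot)
open Summit.QuantumFields.BalabanUV.Beta.FP.PerfectObjectsT (KPerf)

namespace Summit.QuantumFields.BalabanUV.Beta.GAN24.KPerfTailRate

variable {Lc : ℕ} [NeZero Lc]

/-! ## §1 One strip half-width for every relative blocking -/

/-- **(I3′) AT EVERY RELATIVE BLOCKING WITH ONE STRIP HALF-WIDTH** [our proof] (`d = 3`, every `Lc ≥ 1`):
`∃ κ, 0 < κ ∧ κ ≤ 1∕4 ∧ ∃ ρ₀, 0 < ρ₀ ∧ ∀ m, StripRegularKM 3 Lc m κ (cstU (ArrowAnchorReal.aR 4) κ (Lc^m) ρ₀)` — the radii of `exists_radii` depend on the row constants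
only (rows F3–F6 are one-`N` generic), so they are chosen BEFORE `m`; the body is `FibreStripJMHolds.stripRegularKM_of_rows` verbatim at each `m`. -/
theorem stripRegularKM_uniform :
    ∃ κ : ℝ, 0 < κ ∧ κ ≤ 1 / 4 ∧ ∃ ρ₀ : ℝ, 0 < ρ₀ ∧
      ∀ m : ℕ, StripRegularKM 3 Lc m κ (cstU (ArrowAnchorReal.aR 4) κ (Lc ^ m) ρ₀) := by
  obtain ⟨cIn, hcIn, hF4⟩ := ArrowInnerShift.exists_cIn 3
  have haZ : (0 : ℝ) ≤ 5 / 2 := by norm_num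
  have haR : (0 : ℝ) ≤ ArrowAnchorReal.aR 4 := le_of_lt (ArrowAnchorReal.aR_pos 4)
  have hρ₁ : (0 : ℝ) < 1 / 2 := by norm_num
  obtain ⟨ρ₀, κ₀, hρ₀, hρ, hsmallIn, hκ₀, hκ, hκη, hsmallOut⟩ :=
    exists_radii (aZ := 5 / 2) (aR := ArrowAnchorReal.aR 4) (cIn := cIn) (cOut := cOut4) (ρ₁ := 1 / 2) (η₁ := 1) OmegaOut haZ haR hcIn
      cOut4_nonneg hρ₁ one_pos OmegaOut_nonneg
  set κ : ℝ := min κ₀ (1 / 4) with hκdef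
  have hκpos : 0 < κ := lt_min hκ₀ (by norm_num)
  have hκle : κ ≤ κ₀ := min_le_left _ _
  have hκ4 : κ ≤ 1 / 4 := min_le_right _ _
  have hmono : ∀ p : Fin (3 + 1) → ℂ, p ∈ Strip (3 + 1) κ → p ∈ Strip (3 + 1) κ₀ := fun p hp μ => ⟨(hp μ).1, (hp μ).2.trans hκle⟩
  refine ⟨κ, hκpos, hκ4, ρ₀, hρ₀, fun m => ?_⟩
  -- the four rows at the fine blocking `N := Lc^(j+m)` (one-`N` generic tree theorems, instantiated)
  have hF3 : ∀ j : ℕ, IsUnit (arrowMat (innerArrow (Lc ^ (j + m)) (0 : Fin (3 + 1) → ℂ))) ∧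
      ‖(arrowMat (innerArrow (Lc ^ (j + m)) (0 : Fin (3 + 1) → ℂ)))⁻¹‖ ≤ 5 / 2 := fun j => isUnit_innerArrow_zero
  have hF4m : ∀ (j : ℕ) (p : Fin (3 + 1) → ℂ) (r : ℝ), (∀ μ, ‖p μ‖ ≤ r) → r ≤ 1 / 2 →
      ‖arrowMat (innerArrow (Lc ^ (j + m)) p) - arrowMat (innerArrow (Lc ^ (j + m)) 0)‖ ≤ cIn * r :=
    fun j p r hp hr => hF4 (Lc ^ (j + m)) p r hp hr
  have hF5m : ∀ (j : ℕ), ∀ q ∈ BZ (3 + 1), q ≠ 0 → IsUnit (arrowMat (outerArrow (Lc ^ (j + m)) q (ofRealVec q))) ∧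
      ‖(arrowMat (outerArrow (Lc ^ (j + m)) q (ofRealVec q)))⁻¹‖ ≤ ArrowAnchorReal.aR 4 :=
    fun j q hq hq0 => ArrowAnchorReal.arrowAnchorReal (N := Lc ^ (j + m)) (one_le_pow_add j m) (abs_le_pi_of_mem_BZ hq) hq0
  have hF6m : ∀ (j : ℕ), ∀ q ∈ BZ (3 + 1), q ≠ 0 → ∀ p : Fin (3 + 1) → ℂ, reVec p = q → ∀ η : ℝ, 0 ≤ η → η ≤ 1 → (∀ μ, |(p μ).im| ≤ η) →
      ‖arrowMat (outerArrow (Lc ^ (j + m)) q p) - arrowMat (outerArrow (Lc ^ (j + m)) q (ofRealVec q))‖ ≤ cOut4 * η * omegaOut q := by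
    intro j q hq hq0 p hpq η hη0 hη1 him
    have h := ArrowOuterShift.outerLipschitz (D := 4) (N := Lc ^ (j + m)) (one_le_pow_add j m) q hq hq0 p hpq η hη0 hη1 him
    simpa only [cOut4, omegaOut, Nat.cast_ofNat] using h
  have hω : ∀ q ∈ BZ (3 + 1), (∃ μ, ρ₀ / 2 ≤ |q μ|) → omegaOut q ≤ OmegaOut ρ₀ := fun q _ hfar => omegaOut_le hρ₀ q hfar
  -- (U1) at the fine blocking `N = Lc^(j+m)`
  have hU1 : ∀ j, ∀ p ∈ Strip (3 + 1) κ₀, (trigPolySymbol (stencil (3 + 1)) (pieceMatrix (N := Lc ^ (j + m))) p).det ≠ 0 := fun j =>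
    det_ne_zero_of_rows (N := Lc ^ (j + m)) omegaOut (hF3 j) (hF4m j) (hF5m j) (hF6m j) hω haZ haR cOut4_nonneg hρ₀ hρ hsmallIn hκ₀.le hκ hκη
      hsmallOut
  -- (U2) at `(N, M) = (Lc^(j+m), Lc^j)`
  have hU2 : ∀ (j : ℕ) (zx zy : TorusSite (3 + 1) (Lc ^ m)) (a b : Fib 3), ∀ p ∈ Strip (3 + 1) κ,
      ‖kFibΔM Lc (sfStep Lc) (smStep 3 Lc) m j a (repZ zx) b (repZ zy) p‖ ≤ cstU (ArrowAnchorReal.aR 4) κ (Lc ^ m) ρ₀ := by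
    intro j zx zy a b p hp
    have him : ∀ i, |(p i).im| ≤ κ := fun i => (hp i).2
    have hre : ∀ i, |(p i).re| ≤ π := fun i => (hp i).1
    rw [kFibΔM_repZ_eq_kFibW]
    rcases apriori_of_rows (N := Lc ^ (j + m)) omegaOut (hF3 j) (hF4m j) (hF5m j) (hF6m j) hω haZ haR cOut4_nonneg hρ₀ hρ hsmallIn hκ₀.le hκ hκη
        hsmallOut (hmono p hp) with ⟨-, hU, hA⟩ | ⟨hfar, hq0, hU, hA⟩
    · -- inner case: radii `radI`, `r₀ = 1`, `A = 2·(5/2)`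
      obtain ⟨hr, hr4, hr00⟩ := radI_hyps (N := Lc ^ (j + m))
      exact (legBound_jm_of_inv_bound hκpos.le hκ4 m j him hre (radI (Lc ^ (j + m))) hr hr4 one_pos hr00 hU hA a b zx zy).trans (le_max_left _ _)
    · -- outer case: anchor `q = reVec p ∈ BZ ∖ {0}`, radii `radO N q`, `r₀ = radO N q 0 ∈ [ρ₀/π, 2π]`, `A = 2·aR`
      have hq : reVec p ∈ BZ (3 + 1) := reVec_mem_BZ hp
      obtain ⟨hr, hr4⟩ := radO_hyps (N := Lc ^ (j + m)) hq hq0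
      have h1 := legBound_jm_of_inv_bound hκpos.le hκ4 m j him hre (radO (Lc ^ (j + m)) (reVec p)) hr hr4 (hr 0) rfl hU hA a b zx zy
      refine h1.trans ((Real.sqrt_le_sqrt ?_).trans (le_max_right _ _))
      have hlo : ρ₀ / π ≤ radO (Lc ^ (j + m)) (reVec p) 0 := le_radO_zero hq hρ₀ hfar
      have hhi : radO (Lc ^ (j + m)) (reVec p) 0 ≤ 2 * π := radO_zero_le hq
      exact cstSq_mono (A := 2 * ArrowAnchorReal.aR 4) (η := κ) (Lc := Lc ^ m) (by positivity) hlo hhi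
  refine stripRegularKM_of_repZ fun j zx zy a b => ?_
  exact stripRegular_kFibΔM hκpos.le _ _ m j (fun p hp => hU1 j p (hmono p hp)) a (repZ zx) b (repZ zy) (hU2 j zx zy a b)

/-- [our proof] Corollary shape: ONE `κ > 0` with `∀ m, ∃ Cst ≥ 0, StripRegularKM 3 Lc m κ Cst`. -/
theorem exists_kappa_forall_m : ∃ κ : ℝ, 0 < κ ∧ ∀ m : ℕ, ∃ Cst : ℝ, 0 ≤ Cst ∧ StripRegularKM 3 Lc m κ Cst := by
  obtain ⟨κ, hκ, -, ρ₀, -, h⟩ := stripRegularKM_uniform (Lc := Lc)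
  exact ⟨κ, hκ, fun m => ⟨_, cst_nonneg_of_stripRegularKM hκ.le (h m), h m⟩⟩

/-! ## §2 One decay-rate constant `δ₀` for the whole (j, m)-family: rate `δ₀ ∕ Lc^m` -/

/-- **THE `j`-UNIFORM DECAY OF THE (j, m)-RESOLVENTS AT RATE `δ₀ ∕ Lc^m` WITH ONE `δ₀` FOR ALL `m`** [our proof] (`d = 3`, every `Lc ≥ 1`):
`∃ δ₀ > 0, ∀ m, ∃ C ≥ 0, UniformDecays (j ↦ unitK (sfStep Lc j) (smStep 3 Lc j) (KTot (Lc^(j+m)) (Lc^j))) C (δ₀ ∕ Lc^m)` — `FibreStripJM.uniformDecays_of_stripRegularKM` on §1;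
`δ₀ = κ∕(3+1)`, `C = cstU (aR 4) κ (Lc^m) ρ₀ · e^{2κ}` (the only `m`-dependence is in `C`). -/
theorem uniformDecaysKM_uniformRate : ∃ δ₀ : ℝ, 0 < δ₀ ∧ ∀ m : ℕ, ∃ C : ℝ, 0 ≤ C ∧
    UniformDecays (fun j => unitK (sfStep Lc j) (smStep 3 Lc j) (KTot (d := 3) (Lc ^ (j + m)) (Lc ^ j))) C (δ₀ / (Lc : ℝ) ^ m) := by
  obtain ⟨κ, hκ, -, ρ₀, -, h⟩ := stripRegularKM_uniform (Lc := Lc)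
  refine ⟨κ / (3 + 1), by positivity, fun m => ⟨cstU (ArrowAnchorReal.aR 4) κ (Lc ^ m) ρ₀ * Real.exp (2 * κ), ?_, ?_⟩⟩
  · exact mul_nonneg (cst_nonneg_of_stripRegularKM hκ.le (h m)) (Real.exp_pos _).le
  · have hU := uniformDecays_of_stripRegularKM hκ.le (h m)
    rw [div_div]
    simpa only [Nat.cast_ofNat] using hU

/-- [our proof] The same in the bare form `∀ m j, Decays …` with the two-parameter family displayed. -/
theorem decays_KTot_uniformRate : ∃ δ₀ : ℝ, 0 < δ₀ ∧ ∀ m : ℕ, ∃ C : ℝ, 0 ≤ C ∧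
    ∀ j : ℕ, Decays (unitK (sfStep Lc j) (smStep 3 Lc j) (KTot (d := 3) (Lc ^ (j + m)) (Lc ^ j))) C (δ₀ / (Lc : ℝ) ^ m) := by
  obtain ⟨δ₀, hδ₀, h⟩ := uniformDecaysKM_uniformRate (Lc := Lc)
  exact ⟨δ₀, hδ₀, fun m => by obtain ⟨C, hC, hU⟩ := h m; exact ⟨C, hC, fun j => hU j⟩⟩

/-! ## §3 The perfect `m`-fold one-step resolvent: rate `δ₀ ∕ n`, `n = Lc^m`, `δ₀` free of `n` -/

/-- **THE PERFECT ONE-STEP RESOLVENT AT BASE `n = Lc^m` DECAYS AT RATE `δ₀ ∕ Lc^m` WITH `δ₀` INDEPENDENT OF `m`** [our proof] (`d = 3`, `2 ≤ Lc`, every `m ≥ 1`):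
`∃ δ₀ > 0, ∀ m ≥ 1, ∃ C ≥ 0, Decays (KPerf Lc (sfStep Lc) (smStep 3 Lc) m) C (δ₀ ∕ Lc^m)` — `KSlotJMHolds.decays_KPerf_explicit` (X1m-K BY NAME) on §1.
The RATE half of road FP's tail shape (N7c ∕ REP-DESIGN row TAILS); the amplitude `C` is road P1's (U2) constant at ratio `Lc^m`, NOT `n`-uniform (header). -/
theorem decays_KPerf_uniformRate (hLc : 2 ≤ Lc) : ∃ δ₀ : ℝ, 0 < δ₀ ∧ ∀ m : ℕ, 1 ≤ m → ∃ C : ℝ, 0 ≤ C ∧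
    Decays (KPerf (d := 3) Lc (sfStep Lc) (smStep 3 Lc) m) C (δ₀ / (Lc : ℝ) ^ m) := by
  obtain ⟨κ, hκ, -, ρ₀, -, h⟩ := stripRegularKM_uniform (Lc := Lc)
  refine ⟨κ / (3 + 1), by positivity, fun m hm => ⟨cstU (ArrowAnchorReal.aR 4) κ (Lc ^ m) ρ₀ * Real.exp (2 * κ), ?_, ?_⟩⟩
  · exact mul_nonneg (cst_nonneg_of_stripRegularKM hκ.le (h m)) (Real.exp_pos _).le
  · have hD := decays_KPerf_explicit hLc hm hκ.le (h m)
    rw [div_div]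
    simpa only [Nat.cast_ofNat] using hD

/-- [our proof] **`n`-INDEXED READING** (`n := Lc^m` as a natural number cast to `ℝ`): `Decays (KPerf … m) C (δ₀ ∕ n)` with the SAME `δ₀` for every `m ≥ 1` — the shape
`e^{−(δ₀∕n)·|x′ − y′|₁}` of the END's tail envelope, rate part. -/
theorem decays_KPerf_uniformRate_nat (hLc : 2 ≤ Lc) : ∃ δ₀ : ℝ, 0 < δ₀ ∧ ∀ m : ℕ, 1 ≤ m → ∃ C : ℝ, 0 ≤ C ∧
    Decays (KPerf (d := 3) Lc (sfStep Lc) (smStep 3 Lc) m) C (δ₀ / ((Lc ^ m : ℕ) : ℝ)) := by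
  obtain ⟨δ₀, hδ₀, h⟩ := decays_KPerf_uniformRate (Lc := Lc) hLc
  refine ⟨δ₀, hδ₀, fun m hm => ?_⟩
  rw [Nat.cast_pow]
  exact h m hm

/-- [our proof] POINTWISE form for the consumer: `|KPerf … m x′ y′ a b| ≤ C · exp (−(δ₀ ∕ Lc^m) · |x′ − y′|₁)` with one `δ₀` for all `m ≥ 1`. -/
theorem abs_KPerf_le_uniformRate (hLc : 2 ≤ Lc) : ∃ δ₀ : ℝ, 0 < δ₀ ∧ ∀ m : ℕ, 1 ≤ m → ∃ C : ℝ, 0 ≤ C ∧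
    ∀ (x' y' : Fin (3 + 1) → ℤ) (a b : Fib 3),
      |KPerf (d := 3) Lc (sfStep Lc) (smStep 3 Lc) m x' y' a b| ≤ C * Real.exp (-(δ₀ / (Lc : ℝ) ^ m) * B12Sec2to5.l1 (x' - y')) := by
  obtain ⟨δ₀, hδ₀, h⟩ := decays_KPerf_uniformRate (Lc := Lc) hLc
  refine ⟨δ₀, hδ₀, fun m hm => ?_⟩
  obtain ⟨C, hC, hD⟩ := h m hm
  exact ⟨C, hC, fun x' y' a b => hD x' y' a b⟩

end Summit.QuantumFields.BalabanUV.Beta.GAN24.KPerfTailRate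

end
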